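import Literature.MathematicalPhysics.QuantumFieldTheory.Balaban1983to89.Node00.LargeFieldReprOfRecord
import Literature.MathematicalPhysics.QuantumFieldTheory.Balaban1983to89.Node00.BackgroundActionOfRecord
import Literature.MathematicalPhysics.QuantumFieldTheory.Balaban1983to89.B8Eq17ClassAkV1

/-!
# NODE 00 (definitions of record, R-side ₇, FILE 13) — the background field `U_k(s) = U(𝐁_k(s), ·)` OF A (2.18) SEQUENCE, of record

T. Bałaban, *Renormalization group approach to lattice gauge field theories. II … Convergent renormalization expansions*,
Commun. Math. Phys. **119** (1988) 243–285 [Balaban1988Convergent], §2 p. 258 [PDF 16], verbatim: *«[A_k] depends on the gauge field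
variable V, given by (2.10), through the background field U_k(V). This field is determined by the sequence {Ω_j}, or rather its
determining set 𝐁»*; (2.12)–(2.13) pp. 256–257: *«A regular configuration V on 𝔅 determines the minimal orbit … of the functional
U ↦ A(U) on U: U regular and M_𝔅(U) = V. (2.12) … U(𝐁_j(Ω), ·) = U_{j,Ω}(·). (2.13)»*.

HONEST FRAMING (cell `pub-ymgap`, definer seat node00-def-R): definitions of record; nothing of Bałaban asserted ([15] Thm 1 existence ∕
uniqueness-mod-gauge NOT asserted); counts unmoved; one finite `T⁴` torus family at `ε = L^{−K}`; not continuum ∕ OS ∕ mass-gap ∕ Clay.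

WHAT THIS FILE IS.  The ABBREVIATION asked for by node00-def-T's 11c `Sect2FormOfRecord` (pub-ymgap INBOX l.11714: «background map
`U_k(𝔹_k(s), ·) : MSField → GaugeField 0` a PARAMETER until def-R names it»): along a (2.18) sequence of record `s : SeqOfRecord F ν M g K k`
(FILE 4 `LargeFieldReprOfRecord`), the background `U_k(s)` is r11's «background field of a sequence» `B14.Eq218Concrete.Ubg bg k s := bg.U (genSet s.Ω k)`
at THE SAME (2.12) datum FILE 4's `chiSeqOfRecord` pins — FILE 1's `bgOfRecord (avOfRecord F N K) {U | PlaqSmall (ν.εreg·η_k²) U}` — so that `χ_k(s)` and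
`U_k(s)` read ONE solution map (consistency of record).  §1 the regularity class and datum of the large-field side (`regLFOfRecord`,
`regLFOfRecord_eq_bgReg` — it IS node00-def-B's `bgReg … ν.εreg`, `bgLFOfRecord`, `chiSeqOfRecord_eq` rfl); §2 `UbgOfRecord` with its faces (`_apply` rfl to
FILE 1's `UminOfRecord` on `genSet s.Ω k`, `isMinimizer_UbgOfRecord` on the solvable domain, `UbgOfRecord_of_not_mem` junk branch); §3 the no-large-field
junction with the one-scale problem of [I] (0.21): `genSet_eq_atScale_of_top` (a sequence with `Ω_j = T` for `1 ≤ j ≤ k` has the one-scale determining set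
`atScale k`), `isMinimizer_genSet_top_iff` (r12's `isMinimizer_atScale_iff` transported), `mem_solvableDom_top_iff_ukExists` (solvability of the
record's (2.12) problem at such `s` ↔ def-B's `UkExists F N K k ν.εreg (W k)`).  The two CHOSEN solutions (`UbgOfRecord … s W`, def-B's `Uk F N K k ε (W k)`)
are NOT identified (they agree only modulo gauge under `UniqueUkOrbit`, [B11] Thm 1 — named, never asserted).  §4 the SUPPORT SET OF RECORD of 11c's displayed
background proviso `Sect2.BgProviso … Supp U` (p. 259 after (2.28) «(2.7) imply U_k ∈ U^c_j(X, α_{0,j}, α_{1,j})»): print's standing regularity assumption on the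
retained configuration, p. 256 (the sentence before (2.10)) «we assume that the field V_{j−1} is regular on Γ_{j−1} in the sense that |∂V_{j−1} − 1| <
O(L²)ε_{j−1}» — `regSuppOfRecord ν g K k cR s = {𝐖 | ∀ j ≤ k, |𝐖_j(∂p) − 1| < cR·ε_j on the plaquettes of Γ_j(s)}` with `ε_j = epsOfRecord ν g j` (FILE 4) and the
located constant `cR` = print's «O(L²)» (a letter; `O(1)` not computed) — note (2.7) p. 255 itself is the FLOW inequality `B14.FlowIneq27` among the
`log g_j⁻²`, entering only through «proper restrictions on ε_j».  No `instance`, no `notation`, no `sorry`.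

v1.1 (def-R g5, 2026-08-26; APPEND-ONLY — every v1.0 declaration byte-identical): §4 gains the SIGN faces of the letter `cR` located by the 11d
`Record11` reads (dag-ref-D WATCH-11d-CR; def-R R-side read of record): `plaqSmallOn_iff_of_nonpos` ∕ `mem_regSuppOfRecord_iff_of_nonpos` ∕
`mem_regSuppOfRecord_iff_mem_of_nonpos` (for thresholds `cR·ε_j ≤ 0` the support of record does not read `𝐖` — the located junk corner; print's «O(L²)»
is POSITIVE), `epsOfRecord_pos` (`ε_j > 0` on `0 < g_j < 1`, `0 < A₀`), `one_mem_regSuppOfRecord` ∕ `regSuppOfRecord_nonempty` (at print's sign the unit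
configuration is retained: the RANGE WITNESS a consumer of a proviso displayed on `regSuppOfRecord` carries).
-/

noncomputable section

namespace Literature.MathematicalPhysics.QuantumFieldTheory.Balaban1983to89.Node00

open Literature.MathematicalPhysics.QuantumFieldTheory.Balaban1983to89
open T4Continuum B15DeterminingSets

variable (F : T4Family) (N : ℕ) [NeZero N]

/-! ## §1  The regularity class and the (2.12) datum of the large-field side, of record -/

/-- **The regularity class of the large-field side at step `k`** — [III] (2.12) «U regular» read as `|U(∂p) − 1| < εreg·η_k²`
(`η_k = (F.P K).eta k`; numerics `ν.εreg`): the class FILE 4's `chiSeqOfRecord` and FILE 1's `chiOfRecord` use. [cite: Balaban1988Convergent, (2.12) p.256] -/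
def regLFOfRecord (ν : Stage7Numerics) (K k : ℕ) : Set (GaugeField (F.P K) 0 (SU N)) :=
  {U | PlaqSmall (ν.εreg * (F.P K).eta k ^ 2) U}

/-- It IS node00-def-B's regularity class `bgReg` of [I] (1.2) at the letter `ν.εreg` (definitional). [cite: Balaban1987RG1, (1.2) p.260] -/
theorem regLFOfRecord_eq_bgReg (ν : Stage7Numerics) (K k : ℕ) : regLFOfRecord F N ν K k = bgReg F N K k ν.εreg := rfl

/-- Membership (definitional). [cite: Balaban1988Convergent, (2.12) p.256 (bookkeeping)] -/
theorem mem_regLFOfRecord_iff (ν : Stage7Numerics) (K k : ℕ) (U : GaugeField (F.P K) 0 (SU N)) :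
    U ∈ regLFOfRecord F N ν K k ↔ PlaqSmall (ν.εreg * (F.P K).eta k ^ 2) U := Iff.rfl

/-- **The (2.12) datum of record of the large-field representation at step `k`**: FILE 1's `bgOfRecord` along the averaging of record
`avOfRecord F N K` in the class `regLFOfRecord` — literally the datum inside FILE 4's `chiSeqOfRecord`. [cite: Balaban1988Convergent, (2.12)–(2.13) p.256–257] -/
def bgLFOfRecord (ν : Stage7Numerics) (K k : ℕ) : DetBackground (F.P K) (SU N) (avOfRecord F N K) :=
  bgOfRecord (avOfRecord F N K) (regLFOfRecord F N ν K k)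

/-- Its solution map is FILE 1's `UminOfRecord` (definitional). [cite: Balaban1988Convergent, (2.12) p.256 (bookkeeping)] -/
theorem bgLFOfRecord_U (ν : Stage7Numerics) (K k : ℕ) :
    (bgLFOfRecord F N ν K k).U = UminOfRecord (avOfRecord F N K) (regLFOfRecord F N ν K k) := rfl

/-- Its domain is FILE 1's solvable set (definitional). [cite: Balaban1988Convergent, (2.12) p.256 (bookkeeping)] -/
theorem bgLFOfRecord_dom (ν : Stage7Numerics) (K k : ℕ) :
    (bgLFOfRecord F N ν K k).dom = solvableDom (avOfRecord F N K) (regLFOfRecord F N ν K k) := rfl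

/-- CONSISTENCY OF RECORD: FILE 4's `χ_k(s)` is r11's `chi218` at THIS datum (definitional restatement of `chiSeqOfRecord`).
[cite: Balaban1988Convergent, (2.17)–(2.18) p.257] -/
theorem chiSeqOfRecord_eq (ν : Stage7Numerics) (M : ℕ) (g : ℕ → ℝ) (K k : ℕ) (s : SeqOfRecord F ν M g K k) :
    chiSeqOfRecord F N ν M g K k s =
      B14.Eq218Concrete.chi218 (ι := ↥(cubeIndices (F.P K) (cubeSide (F.P K).L ν.M₂ (RkOfRecord (F.P K).L ν.r (g k)) k)))
        (bgLFOfRecord F N ν K k) ν.M₁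
        (fun a => cubeEnl (F.P K) (cubeSide (F.P K).L ν.M₂ (RkOfRecord (F.P K).L ν.r (g k)) k) a 0)
        (fun a => plaqInside (cubeEnl (F.P K) (cubeSide (F.P K).L ν.M₂ (RkOfRecord (F.P K).L ν.r (g k)) k) a 1))
        (fun a => cubeEnl (F.P K) (cubeSide (F.P K).L ν.M₂ (RkOfRecord (F.P K).L ν.r (g k)) k) a 4)
        (epsOfRecord ν g k) k s := rfl

/-! ## §2  `U_k(s)` of record -/

/-- **THE BACKGROUND FIELD OF A SEQUENCE, OF RECORD** — p. 258: *«U_k(V) … is determined by the sequence {Ω_j}, or rather its determining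
set 𝐁»*: `U_k(s)(W) = U(𝐁({Ω_j(s)}), W)`, r11's `B14.Eq218Concrete.Ubg` at the datum of record; `W = {W_j}` the multi-scale variable (2.10).
TOTAL (junk `1` off the solvable set, FILE 1 convention). [cite: Balaban1988Convergent, (2.12)–(2.13) p.256–257, §2 p.258] -/
def UbgOfRecord (ν : Stage7Numerics) (M : ℕ) (g : ℕ → ℝ) (K k : ℕ) (s : SeqOfRecord F ν M g K k) :
    MSField (F.P K) (SU N) → GaugeField (F.P K) 0 (SU N) :=
  B14.Eq218Concrete.Ubg (bgLFOfRecord F N ν K k) k s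

variable {F N}

/-- Unfolding to FILE 1's solution map on the determining set `𝐁({Ω_j}) = genSet s.Ω k` (definitional). [cite: Balaban1988Convergent, (2.13) p.257] -/
theorem UbgOfRecord_apply (ν : Stage7Numerics) (M : ℕ) (g : ℕ → ℝ) (K k : ℕ) (s : SeqOfRecord F ν M g K k)
    (W : MSField (F.P K) (SU N)) :
    UbgOfRecord F N ν M g K k s W = UminOfRecord (avOfRecord F N K) (regLFOfRecord F N ν K k) (genSet s.Ω k) W := rfl

/-- It is r11's `Ubg` at the datum of record (definitional; for consumers typed over `B14.Eq218Concrete`). [cite: Balaban1988Convergent, §2 p.258] -/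
theorem UbgOfRecord_eq_Ubg (ν : Stage7Numerics) (M : ℕ) (g : ℕ → ℝ) (K k : ℕ) (s : SeqOfRecord F ν M g K k) :
    UbgOfRecord F N ν M g K k s = B14.Eq218Concrete.Ubg (bgLFOfRecord F N ν K k) k s := rfl

/-- **THE CHARACTERISING PROPERTY on the solvable domain**: `U_k(s)(W)` IS a minimal configuration of (2.12) for `𝐁({Ω_j(s)})` and `W`
(FILE 1 `isMinimizer_UminOfRecord`; in print the domain contains the regular data by [15] Thm 1 — not asserted). [cite: Balaban1988Convergent, (2.12) p.256] -/
theorem isMinimizer_UbgOfRecord (ν : Stage7Numerics) (M : ℕ) (g : ℕ → ℝ) (K k : ℕ) (s : SeqOfRecord F ν M g K k)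
    {W : MSField (F.P K) (SU N)} (hW : W ∈ solvableDom (avOfRecord F N K) (regLFOfRecord F N ν K k) (genSet s.Ω k)) :
    IsMinimizer (avOfRecord F N K) (regLFOfRecord F N ν K k) (genSet s.Ω k) W (UbgOfRecord F N ν M g K k s W) :=
  B14.Eq218Concrete.isMinimizer_Ubg (bgLFOfRecord F N ν K k) k s hW

/-- On the solvable domain `U_k(s)(W)` is regular: `|U_k(s)(W)(∂p) − 1| < εreg·η_k²` (the (1.11)∕(2.34)-type clause at the record's letter).
[cite: Balaban1988Convergent, (2.12) p.256] -/
theorem UbgOfRecord_mem_reg (ν : Stage7Numerics) (M : ℕ) (g : ℕ → ℝ) (K k : ℕ) (s : SeqOfRecord F ν M g K k)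
    {W : MSField (F.P K) (SU N)} (hW : W ∈ solvableDom (avOfRecord F N K) (regLFOfRecord F N ν K k) (genSet s.Ω k)) :
    UbgOfRecord F N ν M g K k s W ∈ regLFOfRecord F N ν K k :=
  (isMinimizer_UbgOfRecord ν M g K k s hW).1

/-- On the solvable domain the averages of `U_k(s)(W)` agree with `W` on the determining set: `M_𝔅(U_k(s)(W)) = W` ((2.11)–(2.12)).
[cite: Balaban1988Convergent, (2.11)–(2.12) p.256] -/
theorem agreeOn_UbgOfRecord (ν : Stage7Numerics) (M : ℕ) (g : ℕ → ℝ) (K k : ℕ) (s : SeqOfRecord F ν M g K k)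
    {W : MSField (F.P K) (SU N)} (hW : W ∈ solvableDom (avOfRecord F N K) (regLFOfRecord F N ν K k) (genSet s.Ω k)) :
    AgreeOn (genSet s.Ω k) (avgFamily (avOfRecord F N K) (UbgOfRecord F N ν M g K k s W)) W :=
  (isMinimizer_UbgOfRecord ν M g K k s hW).2.1

/-- Off the solvable domain `U_k(s)(W)` is the unit configuration (documented junk default of FILE 1).
[cite: Balaban1988Convergent, (2.12) p.256 (typing convention)] -/
theorem UbgOfRecord_of_not_mem (ν : Stage7Numerics) (M : ℕ) (g : ℕ → ℝ) (K k : ℕ) (s : SeqOfRecord F ν M g K k)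
    {W : MSField (F.P K) (SU N)} (hW : W ∉ solvableDom (avOfRecord F N K) (regLFOfRecord F N ν K k) (genSet s.Ω k)) :
    UbgOfRecord F N ν M g K k s W = fun _ => 1 :=
  UminOfRecord_of_not (avOfRecord F N K) (regLFOfRecord F N ν K k) (by rwa [mem_solvableDom_iff] at hW)

/-! ## §3  The no-large-field junction with the one-scale problem (0.21) [I] -/

section Junction

variable {P : Params}

/-- For a sequence of regions with `Ω_j = T` on the whole window `1 ≤ j ≤ k` (no large-field region created up to step `k ≥ 1`),
the determining set (2.2) `𝐁({Ω_j})` is the ONE-SCALE set `atScale k` («Γ_k = T^{(k)}», all other `Γ_i` empty). [cite: Balaban1988Convergent, (2.2) p.255] -/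
theorem genSet_eq_atScale_of_top (Ω : ℕ → Set (Site P 0)) {k : ℕ} (hk : 1 ≤ k)
    (hΩ : ∀ j, 1 ≤ j → j ≤ k → Ω j = Set.univ) : genSet Ω k = atScale k := by
  funext i
  simp only [genSet, atScale, pts]
  by_cases hik : i = k
  · subst hik
    rw [gammaRegion_self, hΩ i hk le_rfl, if_pos rfl, Set.preimage_univ]
  · rw [if_neg hik]
    rcases lt_or_gt_of_ne hik with hlt | hgt
    · rcases Nat.eq_zero_or_pos i with hi0 | hi0
      · subst hi0
        rw [gammaRegion_zero Ω (by omega), hΩ 1 le_rfl hk, Set.compl_univ, Set.preimage_empty]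
      · rw [gammaRegion_mid Ω hi0 hlt, hΩ i hi0 hlt.le, hΩ (i + 1) (by omega) (by omega), Set.sdiff_self]
        rfl
    · rw [gammaRegion_of_gt Ω hgt, Set.preimage_empty]

/-- At such a sequence the (2.12) problem IS the one-scale problem (0.21) [I] for the datum `W k` (r12's `isMinimizer_atScale_iff`,
transported). [cite: Balaban1988Convergent, (2.12) p.256; Balaban1987RG1, (0.21) p.256] -/
theorem isMinimizer_genSet_top_iff {G : Type*} [GaugeGroup G] (av : ∀ j, Averaging P j G) (reg : Set (GaugeField P 0 G))
    (Ω : ℕ → Set (Site P 0)) {k : ℕ} (hk : 1 ≤ k) (hΩ : ∀ j, 1 ≤ j → j ≤ k → Ω j = Set.univ)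
    (W : MSField P G) (U₀ : GaugeField P 0 G) :
    IsMinimizer av reg (genSet Ω k) W U₀ ↔ IsBackground av reg k (W k) U₀ := by
  rw [genSet_eq_atScale_of_top Ω hk hΩ]
  exact isMinimizer_atScale_iff av reg k W U₀

end Junction

/-- **Solvability junction of record**: at a no-large-field sequence the record's (2.12) problem for `𝐁({Ω_j(s)})` and `W` is solvable iff
node00-def-B's one-scale problem (0.21) at `W k` is (`UkExists F N K k ν.εreg (W k)`) — same averaging of record, same class
(`regLFOfRecord_eq_bgReg`).  The chosen SOLUTIONS are not identified (mod gauge only, [B11] Thm 1). [cite: Balaban1988Convergent, (2.12) p.256; Balaban1987RG1, (1.1) p.260] -/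
theorem mem_solvableDom_top_iff_ukExists (ν : Stage7Numerics) (M : ℕ) (g : ℕ → ℝ) (K k : ℕ) (hk : 1 ≤ k)
    (s : SeqOfRecord F ν M g K k) (hs : ∀ j, 1 ≤ j → j ≤ k → s.Ω j = Set.univ) (W : MSField (F.P K) (SU N)) :
    W ∈ solvableDom (avOfRecord F N K) (regLFOfRecord F N ν K k) (genSet s.Ω k) ↔ UkExists F N K k ν.εreg (W k) := by
  rw [mem_solvableDom_iff]
  simp only [isMinimizer_genSet_top_iff (avOfRecord F N K) (regLFOfRecord F N ν K k) s.Ω hk hs]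
  rfl

/-- At a no-large-field sequence, on the solvable domain, `U_k(s)(W)` is a background field of [I] (0.21) for `W k` in def-B's sense
(`Setup.IsBackground` along `avOfRecord`, class `bgReg … ν.εreg`) — hence in ONE orbit with `Uk F N K k ν.εreg (W k)` whenever `UniqueUkOrbit` holds
(not asserted). [cite: Balaban1987RG1, (0.21) p.256, (1.1) p.260] -/
theorem isBackground_UbgOfRecord_of_top (ν : Stage7Numerics) (M : ℕ) (g : ℕ → ℝ) (K k : ℕ) (hk : 1 ≤ k)
    (s : SeqOfRecord F ν M g K k) (hs : ∀ j, 1 ≤ j → j ≤ k → s.Ω j = Set.univ) {W : MSField (F.P K) (SU N)}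
    (hW : W ∈ solvableDom (avOfRecord F N K) (regLFOfRecord F N ν K k) (genSet s.Ω k)) :
    IsBackground (avOfRecord F N K) (bgReg F N K k ν.εreg) k (W k) (UbgOfRecord F N ν M g K k s W) :=
  (isMinimizer_genSet_top_iff (avOfRecord F N K) (regLFOfRecord F N ν K k) s.Ω hk hs W _).1
    (isMinimizer_UbgOfRecord ν M g K k s hW)

/-- … and therefore in one residual-gauge orbit with def-B's `U_k(W_k)` under the named uniqueness clause `UniqueUkOrbit` ([B11] Thm 1, a
hypothesis). [cite: Balaban1985Variational, Thm 1 p.279] -/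
theorem orbitRel_UbgOfRecord_Uk_of_top (ν : Stage7Numerics) (M : ℕ) (g : ℕ → ℝ) (K k : ℕ) (hk : 1 ≤ k)
    (s : SeqOfRecord F ν M g K k) (hs : ∀ j, 1 ≤ j → j ≤ k → s.Ω j = Set.univ) {W : MSField (F.P K) (SU N)}
    (hW : W ∈ solvableDom (avOfRecord F N K) (regLFOfRecord F N ν K k) (genSet s.Ω k))
    (huniq : UniqueUkOrbit F N K k ν.εreg (W k)) :
    B12GaugeOrbits021.OrbitRel k (UbgOfRecord F N ν M g K k s W) (Uk F N K k ν.εreg (W k)) :=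
  huniq _ _ (isBackground_UbgOfRecord_of_top ν M g K k hk s hs hW)
    (isBackground_Uk ((mem_solvableDom_top_iff_ukExists ν M g K k hk s hs W).1 hW))

/-! ## §4  The support set of record of the background proviso (p. 256 ∕ p. 259) -/

section Support

variable (F N)

/-- **THE REGULAR RETAINED CONFIGURATIONS ON THE DETERMINING SET OF A SEQUENCE, OF RECORD** — p. 256 (before (2.10)), verbatim: *«we assume
that the field V_{j−1} is regular on Γ_{j−1} in the sense that |∂V_{j−1} − 1| < O(L²)ε_{j−1}»*; p. 259 (after (2.28)): *«the inductive assumptions (2.7)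
imply U_k ∈ U^c_j(X, α_{0,j}, α_{1,j}) for proper restrictions on ε_j»*: the multi-scale configurations `𝐖 = {W_j}` whose scale-`j` plaquette variables
on `Γ_j({Ω_i(s)})` (plaquettes of `T^{(j)}` touching `Γ_j`, the Sect. 0 [I] ∕ p. 77 [B12] convention `B8Eq17ClassAkV1.plaqsOf`, as r12's `bondsOf`) satisfy
`|W_j(∂p) − 1| < cR·ε_j`, `ε_j = epsOfRecord ν g j` of FILE 4, `cR` the located constant «O(L²)» (a letter).  The support set on which 11c's
`Sect2.BgProviso` is print-true by [15] Thm 1 — NOT asserted. [cite: Balaban1988Convergent, (2.10) p.256, (2.28) p.259] -/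
def regSuppOfRecord (ν : Stage7Numerics) (M : ℕ) (g : ℕ → ℝ) (K k : ℕ) (cR : ℝ) (s : SeqOfRecord F ν M g K k) :
    Set (MSField (F.P K) (SU N)) :=
  {W | ∀ j, j ≤ k → PlaqSmallOn (B8Eq17ClassAkV1.plaqsOf (genSet s.Ω k j)) (cR * epsOfRecord ν g j) (W j)}

/-- Membership (definitional). [cite: Balaban1988Convergent, (2.10) p.256 (bookkeeping)] -/
theorem mem_regSuppOfRecord_iff (ν : Stage7Numerics) (M : ℕ) (g : ℕ → ℝ) (K k : ℕ) (cR : ℝ) (s : SeqOfRecord F ν M g K k)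
    (W : MSField (F.P K) (SU N)) :
    W ∈ regSuppOfRecord F N ν M g K k cR s ↔
      ∀ j, j ≤ k → PlaqSmallOn (B8Eq17ClassAkV1.plaqsOf (genSet s.Ω k j)) (cR * epsOfRecord ν g j) (W j) := Iff.rfl

/-- The support set grows with the located constant (bookkeeping: a larger «O(L²)» admits more configurations), for `0 ≤ ε_j`.
[cite: Balaban1988Convergent, (2.10) p.256 (bookkeeping)] -/
theorem regSuppOfRecord_mono (ν : Stage7Numerics) (M : ℕ) (g : ℕ → ℝ) (K k : ℕ) {cR cR' : ℝ} (h : cR ≤ cR')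
    (hε : ∀ j, j ≤ k → 0 ≤ epsOfRecord ν g j) (s : SeqOfRecord F ν M g K k) :
    regSuppOfRecord F N ν M g K k cR s ⊆ regSuppOfRecord F N ν M g K k cR' s :=
  fun _ hW j hj p hp => lt_of_lt_of_le (hW j hj p hp) (mul_le_mul_of_nonneg_right h (hε j hj))

/-- Beyond the top scale the condition is empty (`Γ_j = ∅` for `j > k`), so only `j ≤ k` is quantified; at a scale with empty `Γ_j(s)` the clause is
vacuous. [cite: Balaban1988Convergent, (2.2) p.255 (bookkeeping)] -/
theorem plaqSmallOn_of_genSet_eq_empty {ν : Stage7Numerics} {M : ℕ} {g : ℕ → ℝ} {K k : ℕ} (s : SeqOfRecord F ν M g K k) {j : ℕ}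
    (hj : genSet s.Ω k j = ∅) (δ : ℝ) (Wj : GaugeField (F.P K) j (SU N)) : PlaqSmallOn (B8Eq17ClassAkV1.plaqsOf (genSet s.Ω k j)) δ Wj := by
  intro p hp
  rw [hj] at hp
  simp [B8Eq17ClassAkV1.plaqsOf] at hp

/-! ### v1.1 — the sign of the letter `cR`: located junk corner and the range witness -/

/-- For a NON-POSITIVE threshold the small-plaquette condition does not read the configuration (`0 ≤ |g − 1|`): it holds iff the plaquette family is
empty.  (Print's thresholds are positive; this is the located junk corner of a letter chosen with the wrong sign.) [cite: Balaban1988Convergent, (1.4) p.247 (bookkeeping)] -/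
theorem plaqSmallOn_iff_of_nonpos {P : Params} {j : ℕ} {G : Type*} [GaugeGroup G] (S : Set (Plaq P j)) {δ : ℝ} (hδ : δ ≤ 0)
    (U : GaugeField P j G) : PlaqSmallOn S δ U ↔ ∀ q, q ∉ S :=
  ⟨fun h q hq => (not_lt.mpr (hδ.trans (GaugeGroup.dist1_nonneg _))) (h q hq), fun h q hq => (h q hq).elim⟩

/-- **THE LOCATED JUNK CORNER OF THE LETTER `cR`**: if `cR·ε_j ≤ 0` at every `j ≤ k` (e.g. `cR ≤ 0` with `0 ≤ ε_j`), membership in the support of record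
does not read `𝐖` — per sequence the support is all or nothing (nothing as soon as some `Γ_j(s)` carries a plaquette), and a proviso displayed on it then
says nothing of print.  Print's «O(L²)» of p. 256 is a POSITIVE constant; a numerics record carrying no sign law for `cR` (11d's `Sect2Numerics.Pos`)
leaves this corner to the record's choice — consumers wanting range take `0 < cR` (`one_mem_regSuppOfRecord`). [cite: Balaban1988Convergent, (2.10) p.256 (bookkeeping)] -/
theorem mem_regSuppOfRecord_iff_of_nonpos (ν : Stage7Numerics) (M : ℕ) (g : ℕ → ℝ) (K k : ℕ) {cR : ℝ}
    (hc : ∀ j, j ≤ k → cR * epsOfRecord ν g j ≤ 0) (s : SeqOfRecord F ν M g K k) (W : MSField (F.P K) (SU N)) :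
    W ∈ regSuppOfRecord F N ν M g K k cR s ↔ ∀ j, j ≤ k → ∀ q, q ∉ B8Eq17ClassAkV1.plaqsOf (genSet s.Ω k j) :=
  forall_congr' fun j => forall_congr' fun hj => plaqSmallOn_iff_of_nonpos _ (hc j hj) _

/-- … so at such thresholds any two configurations are retained or discarded together. [cite: Balaban1988Convergent, (2.10) p.256 (bookkeeping)] -/
theorem mem_regSuppOfRecord_iff_mem_of_nonpos (ν : Stage7Numerics) (M : ℕ) (g : ℕ → ℝ) (K k : ℕ) {cR : ℝ}
    (hc : ∀ j, j ≤ k → cR * epsOfRecord ν g j ≤ 0) (s : SeqOfRecord F ν M g K k) (W W' : MSField (F.P K) (SU N)) :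
    W ∈ regSuppOfRecord F N ν M g K k cR s ↔ W' ∈ regSuppOfRecord F N ν M g K k cR s := by
  rw [mem_regSuppOfRecord_iff_of_nonpos F N ν M g K k hc s W, mem_regSuppOfRecord_iff_of_nonpos F N ν M g K k hc s W']

/-- **THE SIGN OF THE THRESHOLDS**: for a coupling in the window `0 < g_k < 1` and a positive profile constant `A₀`, `ε_k = g_k·A₀(log g_k⁻²)^{p₀} > 0`.
[cite: Balaban1988Convergent, (2.4) p.255 (bookkeeping)] -/
theorem epsOfRecord_pos (ν : Stage7Numerics) (hA : 0 < ν.A₀) {g : ℕ → ℝ} {k : ℕ} (hg₀ : 0 < g k) (hg₁ : g k < 1) :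
    0 < epsOfRecord ν g k := by
  unfold epsOfRecord p0Profile
  have hsq : g k ^ 2 < 1 := by nlinarith
  have hlog : 0 < Real.log (g k ^ 2)⁻¹ := Real.log_pos ((one_lt_inv₀ (pow_pos hg₀ 2)).mpr hsq)
  exact mul_pos hg₀ (mul_pos hA (pow_pos hlog _))

/-- **NON-EMPTINESS OF THE SUPPORT OF RECORD AT PRINT'S SIGN**: with `0 < cR` and positive thresholds the unit configuration `𝐖 ≡ 1` is retained by every
sequence (`1(∂p) = 1`, `|1 − 1| = 0`) — the RANGE WITNESS a consumer of a proviso displayed on `regSuppOfRecord` carries (e.g. 11d's `Provisos₁₁.bg`,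
`norm_E_bg_le_stage11`). [cite: Balaban1988Convergent, (2.10) p.256 (bookkeeping); Balaban1985Averaging, (9) p.18] -/
theorem one_mem_regSuppOfRecord (ν : Stage7Numerics) (M : ℕ) (g : ℕ → ℝ) (K k : ℕ) {cR : ℝ} (hcR : 0 < cR)
    (hε : ∀ j, j ≤ k → 0 < epsOfRecord ν g j) (s : SeqOfRecord F ν M g K k) :
    (fun j => (1 : GaugeField (F.P K) j (SU N))) ∈ regSuppOfRecord F N ν M g K k cR s := by
  intro j hj q _
  have h1 : GaugeField.plaqHol (1 : GaugeField (F.P K) j (SU N)) q = 1 := by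
    show (1 : SU N) * 1 * (1 : SU N)⁻¹ * (1 : SU N)⁻¹ = 1
    simp
  rw [h1, GaugeGroup.dist1_one]
  exact mul_pos hcR (hε j hj)

/-- … hence at print's sign the support of record of every sequence is non-empty. [cite: Balaban1988Convergent, (2.10) p.256 (bookkeeping)] -/
theorem regSuppOfRecord_nonempty (ν : Stage7Numerics) (M : ℕ) (g : ℕ → ℝ) (K k : ℕ) {cR : ℝ} (hcR : 0 < cR)
    (hε : ∀ j, j ≤ k → 0 < epsOfRecord ν g j) (s : SeqOfRecord F ν M g K k) :
    (regSuppOfRecord F N ν M g K k cR s).Nonempty :=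
  ⟨_, one_mem_regSuppOfRecord F N ν M g K k hcR hε s⟩

end Support

end Literature.MathematicalPhysics.QuantumFieldTheory.Balaban1983to89.Node00

end
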